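import Mathlib.NumberTheory.LSeries.Convolution
import Mathlib.NumberTheory.LSeries.Injectivity
import Literature.NumberTheory.EllipticCurves.NewformsEigenformDegeneracySpanProofs
import Literature.NumberTheory.EllipticCurves.NewformsTwistPacketProofs
import Literature.NumberTheory.EllipticCurves.CuspFormTwistFrickeProofs
import Literature.NumberTheory.EllipticCurves.CuspFormLFunctionNewformFrickeProofs
import Literature.NumberTheory.EllipticCurves.CuspFormLFunctionLevelConductorProofs
import Literature.NumberTheory.EllipticCurves.AtkinLehnerInvolutionsNewformProofs
import HarnessLib

/-!
# The quadratic twist of a newform by a character of prime-power conductor prime to the level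
# is a newform (Atkin–Li), proved

A `…Proofs` companion (theorems only: no definition, no named fact, no instance; D-0026) of
`Literature.NumberTheory.EllipticCurves.CuspFormTwist` / `NewformsTwistPacketProofs`.

**Theorem** (`isNewform0_charTwist_of_isPrimePow_of_coprime`).  Let `f ∈ S_k(Γ₀(N))` be a newform and
`ψ` a primitive quadratic Dirichlet character mod `m`, where `m = q^c` (`c ≥ 1`) is a prime power
with `(N, m) = 1` (so `ψ` is the quadratic character of conductor `q` for odd `q`, or `χ₋₄`, `χ_{±8}`).
Then the twist `f_ψ = ∑ ψ(n) aₙ(f) qⁿ ∈ S_k(Γ₀(N m²))` (`charTwist`, Shimura 1971, Prop. 3.64) is a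
NEWFORM of level `N m²`.  This is the case `(cond ψ, N) = 1` of Atkin–Li 1978, §3 (Thm. 3.1: the
exact level of the newform equivalent to `F_χ`), which `NewformsTwistPacketProofs` left open ("the
exact level `lcm` formula of Atkin–Li 1978, Thm. 3.1 (not proved here)": there only a newform `g`
of SOME level `M`, `M ∣ N m²`, `N ∣ M m²`, with the packet of `f_ψ` is produced).

**Proof** (classical, by Hecke's converse direction: two functional equations for one Dirichlet
series pin the level; compare the tree's `WeierstrassCurve.level_eq_and_sign_eq_of_completedLContinuations`
and `level_eq_conductorNorm_of_hasFunctionalEquationSign`).  Let `g ∈ S_k(Γ₀(M))` be the newform with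
the packet of `f_ψ` (`exists_isNewform0_charTwist_packet`); `(N, m) = 1` forces `M = N q^j`,
`j ≤ 2c`.  By the Atkin–Lehner decomposition and strong multiplicity one
(`exists_cuspCoeff_eq_sum_of_eigenpacket`, `NewformsEigenformDegeneracySpanProofs`),
`f_ψ = ∑_{i ≤ e} p_i g(q^i τ)` with `e = 2c - j`, and comparing the coefficients at the powers of `q`
(where `a_{q^r}(f_ψ) = 0` for `r ≥ 1`) gives `∑ p_i X^i = 1 - a_q(g) X + 𝟙_{q ∤ M} q^{k-1} X²`, the
inverse of the Euler factor of `g` at `q` (`polynomial_eq_of_coeff_recursion`); hence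
`L(f_ψ, s) = P(s) L(g, s)` with `P(s) = ∑ p_i q^{-is}` (`cuspFormLSeries_eq_mul_of_cuspCoeff_eq_sum`).
Now `f_ψ` is a `w_{Nm²}`-eigenform (`frickeInvolution_charTwist_of_eq_smul`: eigenvalue
`ψ(-1)ψ(N)ε(f)`), so `Λ_{Nm²}(f_ψ, s)` satisfies Hecke's functional equation
(`exists_functional_equation_of_frickeInvolution_eq_smul`), and so does `Λ_M(g, s)`
(`IsNewform0.exists_functional_equation_holds`).  Since `Λ_{Nm²}(f_ψ, s) = (q^e)^{s/2} P(s) Λ_M(g, s)`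
(uniqueness of the continuation, `completedL_twoSided_identity`), evaluating the two functional
equations at `s = -2t`, `t → ∞` (where `Λ_M(g, k + 2t) ≠ 0` because `L(g, σ) → a₁(g) = 1`,
`exists_forall_completedCuspFormL_ne_zero`) yields a polynomial identity in `u = q^t` whose extreme
coefficients give `p_e ≠ 0` and `p_e² = q^{ek}` (`sq_eq_of_twoSided_identity`).  For `e ≥ 3`, `p_e = 0`;
for `e = 2`, `p₂ ∈ {0, q^{k-1}}`; for `e = 1`, `p₁ = -a_q(g)` with `a_q(g) = 0` (`q² ∣ M`,
`cuspCoeff_eq_zero_of_sq_dvd_of_mem_newSubspace0`) or `a_q(g)² = q^{k-2}` (`q ∥ M`, Atkin–Lehner: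
`a_q = -q^{k/2-1} λ_q`, `IsNewform0.atkinLehnerEigenvalueAt_eq_of_not_dvd`) — a contradiction in every
case.  So `e = 0`, `M = N m²`, and `f_ψ = g` is a newform.

Only facts PROVED in the tree are used (no named fact is consumed); the result is unconditional.
A general conductor `m` prime to `N` reduces to this case by twisting one prime power at a time
(not done here).  Consumed by the twist invariance of modularity of elliptic curves
(`Literature.NumberTheory.Automorphic.BCDT.IsModular`) in the coprime case.

## References

* [AtkinLi1978] A. O. L. Atkin, W.-C. W. Li, *Twists of newforms and pseudo-eigenvalues of
  `W`-operators*, Invent. Math. 48 (1978), 221–243, §3, Thm. 3.1 (not held; acquisition requested,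
  acq-07478).
* [Shimura1971] G. Shimura, *Introduction to the arithmetic theory of automorphic functions*,
  Prop. 3.64 (the twist `f_ψ ∈ S_k(Γ₀(N m²))`).
* [AtkinLehner1970] A. O. L. Atkin, J. Lehner, *Hecke operators on `Γ₀(m)`*, Math. Ann. 185 (1970),
  Thms. 3, 4, 5 and §6.
* [DiamondShurman2005] F. Diamond, J. Shurman, *A first course in modular forms*, GTM 228 (2005),
  Prop. 5.8.5, Thm. 5.8.3, Thm. 5.10.2.
* [Hecke1936] E. Hecke, Math. Ann. 112 (1936) (functional equation).
-/

noncomputable section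

open scoped MatrixGroups ModularForm

open CongruenceSubgroup UpperHalfPlane Complex Filter Polynomial

namespace Literature.NumberTheory.EllipticCurves.ModularForms

/-! ### Step 1. The coefficients of `f_ψ = ∑ p_i g(q^i τ)` at the powers of `q` -/

section Recursion

variable {M : ℕ} [NeZero M] {k : ℤ}

/-- **The combination is the inverse Euler factor.**  Let `g ∈ S_k(Γ₀(M))` be a newform, `q` a prime,
`e ≥ 0` and `p₀, …, p_e ∈ ℂ` with `∑_{i ≤ min(r, e)} p_i a_{q^{r-i}}(g) = 𝟙_{r = 0}` for every `r ≥ 0`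
(the `q^r`-th coefficients of a form `∑_{i ≤ e} p_i g(q^i τ)` whose coefficients at `q, q², …`
vanish and whose first coefficient is `1`).  Then, as polynomials,
`∑_{i ≤ e} p_i X^i = 1 - a_q(g) X + 𝟙_{q ∤ M} q^{k-1} X²`: both sides are inverses in `ℂ⟦X⟧` of the
local series `∑_r a_{q^r}(g) X^r`, the right-hand side by the Hecke recursion
`a_{q^{r+1}} = a_q a_{q^r} - 𝟙_{q ∤ M} q^{k-1} a_{q^{r-1}}` of the newform `g`
(`IsNewform0.cuspCoeff_prime_mul`; Diamond–Shurman Prop. 5.8.5, Atkin–Lehner 1970, Thm. 3).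
[cite: DiamondShurman2005, Prop. 5.8.5] -/
theorem polynomial_eq_of_coeff_recursion {g : CuspForm (Gamma0 M) k} (hg : IsNewform0 g)
    {q : ℕ} (hq : q.Prime) (e : ℕ) (p : ℕ → ℂ)
    (h : ∀ r : ℕ, ∑ i ∈ Finset.range (e + 1),
      p i * (if i ≤ r then cuspCoeff g (q ^ (r - i)) else 0) = if r = 0 then 1 else 0) :
    ∑ i ∈ Finset.range (e + 1), C (p i) * X ^ i =
      1 - C (cuspCoeff g q) * X + C (if q ∣ M then 0 else (q : ℂ) ^ (k - 1)) * X ^ 2 := by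
  classical
  -- the local series `B = ∑_r a_{q^r}(g) X^r` and the two candidate inverses
  set B : PowerSeries ℂ := PowerSeries.mk fun r ↦ cuspCoeff g (q ^ r) with hB
  set P : ℂ[X] := ∑ i ∈ Finset.range (e + 1), C (p i) * X ^ i with hP
  set Q : ℂ[X] := 1 - C (cuspCoeff g q) * X + C (if q ∣ M then 0 else (q : ℂ) ^ (k - 1)) * X ^ 2
    with hQ
  have hPcoeff : ∀ i : ℕ, P.coeff i = if i ≤ e then p i else 0 := by
    intro i
    rw [hP, finsetSum_coeff]
    simp only [coeff_C_mul, coeff_X_pow, mul_ite, mul_one, mul_zero]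
    rw [Finset.sum_ite_eq]
    simp [Finset.mem_range]
  -- both finite sums are `∑_{i ≤ min(r, e)} p_i a_{q^{r-i}}`
  have key : ∀ r : ℕ, ∑ i ∈ Finset.range (r + 1), (if i ≤ e then p i else 0) * cuspCoeff g (q ^ (r - i)) =
      ∑ i ∈ Finset.range (e + 1), p i * (if i ≤ r then cuspCoeff g (q ^ (r - i)) else 0) := by
    intro r
    have h1 : ∑ i ∈ Finset.range (r + 1), (if i ≤ e then p i else 0) * cuspCoeff g (q ^ (r - i)) =
        ∑ i ∈ Finset.range (e + r + 1),
          (if i ≤ e then p i else 0) * (if i ≤ r then cuspCoeff g (q ^ (r - i)) else 0) := by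
      refine Finset.sum_subset_zero_on_sdiff (Finset.range_subset_range.mpr (by omega)) ?_ ?_
      · intro i hi
        simp only [Finset.mem_sdiff, Finset.mem_range] at hi
        rw [if_neg (by omega : ¬ i ≤ r), mul_zero]
      · intro i hi
        rw [Finset.mem_range] at hi
        rw [if_pos (by omega : i ≤ r)]
    have h2 : ∑ i ∈ Finset.range (e + 1), p i * (if i ≤ r then cuspCoeff g (q ^ (r - i)) else 0) =
        ∑ i ∈ Finset.range (e + r + 1),
          (if i ≤ e then p i else 0) * (if i ≤ r then cuspCoeff g (q ^ (r - i)) else 0) := by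
      refine Finset.sum_subset_zero_on_sdiff (Finset.range_subset_range.mpr (by omega)) ?_ ?_
      · intro i hi
        simp only [Finset.mem_sdiff, Finset.mem_range] at hi
        rw [if_neg (by omega : ¬ i ≤ e), zero_mul]
      · intro i hi
        rw [Finset.mem_range] at hi
        rw [if_pos (by omega : i ≤ e)]
    rw [h1, h2]
  -- `P * B = 1`
  have hPB : (P : PowerSeries ℂ) * B = 1 := by
    ext r
    rw [PowerSeries.coeff_mul, PowerSeries.coeff_one,
      Finset.Nat.sum_antidiagonal_eq_sum_range_succ
        (fun i j ↦ PowerSeries.coeff i (P : PowerSeries ℂ) * PowerSeries.coeff j B)]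
    simp only [Polynomial.coeff_coe, hPcoeff, hB, PowerSeries.coeff_mk]
    rw [key r, h r]
  -- `Q * B = 1` (the Hecke recursion at `q`)
  have hrec : ∀ r : ℕ, cuspCoeff g (q ^ (r + 1)) = cuspCoeff g q * cuspCoeff g (q ^ r) -
      (if q ∣ M then 0 else (q : ℂ) ^ (k - 1)) * (if r = 0 then 0 else cuspCoeff g (q ^ (r - 1))) := by
    intro r
    rw [pow_succ', hg.cuspCoeff_prime_mul hq (q ^ r)]
    congr 1
    by_cases hqM : q ∣ M
    · rw [if_pos hqM, if_pos hqM, zero_mul]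
    · rw [if_neg hqM, if_neg hqM]
      rcases Nat.eq_zero_or_pos r with rfl | hr
      · rw [if_pos rfl, pow_zero, if_neg hq.not_dvd_one, mul_zero]
      · rw [if_pos (dvd_pow_self q hr.ne'), if_neg hr.ne']
        obtain ⟨r', rfl⟩ := Nat.exists_eq_succ_of_ne_zero hr.ne'
        rw [Nat.succ_sub_one, pow_succ, Nat.mul_div_cancel _ hq.pos]
  have h1 : cuspCoeff g 1 = 1 := hg.2.2
  have hQcoeff0 : Q.coeff 0 = 1 := by simp [hQ]
  have hQcoeff1 : Q.coeff 1 = -cuspCoeff g q := by simp [hQ, coeff_one]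
  have hQcoeff2 : Q.coeff 2 = (if q ∣ M then 0 else (q : ℂ) ^ (k - 1)) := by
    simp [hQ, coeff_one]
  have hQcoeff : ∀ i : ℕ, 3 ≤ i → Q.coeff i = 0 := by
    intro i hi
    have h1i : (1 : ℕ) ≠ i := by omega
    simp [hQ, coeff_one, coeff_X, coeff_C_mul, coeff_X_pow, show i ≠ 0 by omega,
      show i ≠ 2 by omega, h1i]
  have hQB : (Q : PowerSeries ℂ) * B = 1 := by
    ext r
    rw [PowerSeries.coeff_mul, PowerSeries.coeff_one,
      Finset.Nat.sum_antidiagonal_eq_sum_range_succ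
        (fun i j ↦ PowerSeries.coeff i (Q : PowerSeries ℂ) * PowerSeries.coeff j B)]
    simp only [Polynomial.coeff_coe, hB, PowerSeries.coeff_mk]
    rcases Nat.lt_or_ge r 2 with hr | hr
    · interval_cases r
      · simp [hQcoeff0, h1]
      · simp [Finset.sum_range_succ, hQcoeff0, hQcoeff1, h1]
    · obtain ⟨r', rfl⟩ : ∃ r', r = r' + 2 := ⟨r - 2, by omega⟩
      rw [if_neg (by omega)]
      -- only `i = 0, 1, 2` contribute
      rw [← Finset.sum_range_add_sum_Ico _ (show 3 ≤ r' + 2 + 1 by omega)]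
      rw [Finset.sum_eq_zero (s := Finset.Ico 3 (r' + 2 + 1)) (fun i hi ↦ by
        rw [Finset.mem_Ico] at hi
        rw [hQcoeff i hi.1, zero_mul]), add_zero]
      simp only [Finset.sum_range_succ, Finset.sum_range_zero, zero_add, hQcoeff0, hQcoeff1, hQcoeff2]
      have h3 := hrec (r' + 1)
      rw [if_neg (Nat.succ_ne_zero r')] at h3
      rw [show r' + 2 - 0 = r' + 1 + 1 by omega, show r' + 2 - 1 = r' + 1 by omega,
        show r' + 2 - 2 = r' + 1 - 1 by omega, h3]
      ring
  -- hence `P = Q`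
  have hPQ : (P : PowerSeries ℂ) = Q := by
    calc (P : PowerSeries ℂ) = P * (Q * B) := by rw [hQB, mul_one]
      _ = Q * (P * B) := by ring
      _ = Q := by rw [hPB, mul_one]
  exact Polynomial.coe_inj.mp hPQ

/-- **The coefficients `p_i`, read off** from `polynomial_eq_of_coeff_recursion`: `p₀ = 1`,
`p₁ = -a_q(g)` (if `e ≥ 1`), `p₂ = 𝟙_{q ∤ M} q^{k-1}` (if `e ≥ 2`), and `p_i = 0` for `3 ≤ i ≤ e`.
[cite: DiamondShurman2005, Prop. 5.8.5] -/
theorem coeff_values_of_coeff_recursion {g : CuspForm (Gamma0 M) k} (hg : IsNewform0 g)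
    {q : ℕ} (hq : q.Prime) (e : ℕ) (p : ℕ → ℂ)
    (h : ∀ r : ℕ, ∑ i ∈ Finset.range (e + 1),
      p i * (if i ≤ r then cuspCoeff g (q ^ (r - i)) else 0) = if r = 0 then 1 else 0) :
    p 0 = 1 ∧ (1 ≤ e → p 1 = -cuspCoeff g q) ∧
      (2 ≤ e → p 2 = if q ∣ M then 0 else (q : ℂ) ^ (k - 1)) ∧
      ∀ i : ℕ, 3 ≤ i → i ≤ e → p i = 0 := by
  classical
  have hPQ := polynomial_eq_of_coeff_recursion hg hq e p h
  have hcoeff : ∀ n : ℕ, (if n ≤ e then p n else 0) =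
      (1 - C (cuspCoeff g q) * X + C (if q ∣ M then 0 else (q : ℂ) ^ (k - 1)) * X ^ 2 : ℂ[X]).coeff n := by
    intro n
    rw [← hPQ, finsetSum_coeff]
    simp only [coeff_C_mul, coeff_X_pow, mul_ite, mul_one, mul_zero]
    rw [Finset.sum_ite_eq]
    simp [Finset.mem_range]
  refine ⟨?_, fun he ↦ ?_, fun he ↦ ?_, fun i hi hie ↦ ?_⟩
  · have h0 := hcoeff 0
    rw [if_pos (Nat.zero_le e)] at h0
    rw [h0]
    simp
  · have h1 := hcoeff 1
    rw [if_pos he] at h1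
    rw [h1]
    simp [coeff_one]
  · have h2 := hcoeff 2
    rw [if_pos he] at h2
    rw [h2]
    simp [coeff_one]
  · have h3 := hcoeff i
    rw [if_pos hie] at h3
    rw [h3]
    have h1i : (1 : ℕ) ≠ i := by omega
    simp [coeff_one, coeff_X, coeff_C_mul, coeff_X_pow, show i ≠ 0 by omega, show i ≠ 2 by omega, h1i]

end Recursion

/-! ### Step 2. The algebra of the two functional equations -/

section Algebra

/-- **Extreme coefficients of the two-sided identity.**  Let `q ≥ 2`, `e ≥ 0`, `k ∈ ℤ`,
`p₀ = 1, p₁, …, p_e ∈ ℂ`, `A ≠ 0` and `B ∈ ℂ` with, for all large `t ∈ ℕ`,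
`A q^{et} ∑_{i ≤ e} p_i q^{-ik} q^{-2it} = B q^{-et} ∑_{i ≤ e} p_i q^{2it}`
(the functional equations of `Λ(f_ψ, s) = (q^e)^{s/2} P(q^{-s}) Λ(g, s)` and of `Λ(g, s)` compared at
`s = -2t`).  Then `p_e ≠ 0` and `p_e² = q^{ek}`: after multiplication by `u^{3e}`, `u = q^t`, this is
a polynomial identity `A ∑ p_i q^{-ik} u^{4e-2i} = B ∑ p_i u^{2e+2i}` with infinitely many roots, and
its coefficients at `u^{4e}` and `u^{2e}` read `A = B p_e`, `A p_e q^{-ek} = B`. [folklore] -/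
theorem sq_eq_of_twoSided_identity {q : ℕ} (hq : 2 ≤ q) (e : ℕ) (k : ℤ) {p : ℕ → ℂ}
    (hp0 : p 0 = 1) {A B : ℂ} (hA : A ≠ 0) (t₀ : ℕ)
    (h : ∀ t : ℕ, t₀ ≤ t →
      A * (q : ℂ) ^ (e * t) * ∑ i ∈ Finset.range (e + 1),
          p i * (((q : ℂ) ^ i) ^ k)⁻¹ * ((q : ℂ) ^ (2 * i * t))⁻¹ =
        B * ((q : ℂ) ^ (e * t))⁻¹ * ∑ i ∈ Finset.range (e + 1), p i * (q : ℂ) ^ (2 * i * t)) :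
    p e ≠ 0 ∧ p e ^ 2 = ((q : ℂ) ^ e) ^ k := by
  classical
  have hq0 : (q : ℂ) ≠ 0 := Nat.cast_ne_zero.mpr (by omega)
  -- the polynomial identity in `u = q^t`
  set R : ℂ[X] := ∑ i ∈ Finset.range (e + 1), C (A * p i * (((q : ℂ) ^ i) ^ k)⁻¹) * X ^ (4 * e - 2 * i) -
      ∑ i ∈ Finset.range (e + 1), C (B * p i) * X ^ (2 * e + 2 * i) with hR
  have heval : ∀ t : ℕ, t₀ ≤ t → R.eval ((q : ℂ) ^ t) = 0 := by
    intro t ht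
    have key := h t ht
    have hmul := congrArg (fun z : ℂ ↦ z * (q : ℂ) ^ (3 * e * t)) key
    simp only [Finset.sum_mul, Finset.mul_sum] at hmul
    rw [hR, eval_sub, eval_finsetSum, eval_finsetSum, sub_eq_zero]
    simp only [eval_mul, eval_C, eval_pow, eval_X]
    convert hmul using 1
    · refine Finset.sum_congr rfl fun i hi ↦ ?_
      rw [Finset.mem_range] at hi
      obtain ⟨d, rfl⟩ : ∃ d, e = i + d := ⟨e - i, by omega⟩
      rw [show 4 * (i + d) - 2 * i = 2 * i + 4 * d by omega]
      field_simp
      ring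
    · refine Finset.sum_congr rfl fun i _ ↦ ?_
      field_simp
      ring
  have hR0 : R = 0 := by
    apply Polynomial.eq_zero_of_infinite_isRoot
    have hinj : Function.Injective fun t : ℕ ↦ ((q : ℂ) ^ t) := by
      intro t₁ t₂ h12
      have h' : ((q ^ t₁ : ℕ) : ℂ) = ((q ^ t₂ : ℕ) : ℂ) := by push_cast; exact h12
      exact Nat.pow_right_injective hq (Nat.cast_injective h')
    refine Set.Infinite.mono (s := (fun t : ℕ ↦ (q : ℂ) ^ t) '' Set.Ici t₀) ?_
      ((Set.Ici_infinite t₀).image hinj.injOn)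
    rintro _ ⟨t, ht, rfl⟩
    exact heval t ht
  -- the coefficients of `R` at `4e` and `2e`
  have hcoeff : ∀ n : ℕ, R.coeff n =
      ∑ i ∈ Finset.range (e + 1), (if n = 4 * e - 2 * i then A * p i * (((q : ℂ) ^ i) ^ k)⁻¹ else 0) -
        ∑ i ∈ Finset.range (e + 1), (if n = 2 * e + 2 * i then B * p i else 0) := by
    intro n
    rw [hR, coeff_sub, finsetSum_coeff, finsetSum_coeff]
    simp only [coeff_C_mul, coeff_X_pow, mul_ite, mul_one, mul_zero]
  have h4e : A - B * p e = 0 := by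
    have h0 := hcoeff (4 * e)
    rw [hR0, coeff_zero] at h0
    rw [Finset.sum_eq_single 0 (fun i hi hi0 ↦ by
        rw [Finset.mem_range] at hi
        rw [if_neg (by omega)]) (by simp),
      Finset.sum_eq_single e (fun i hi hie ↦ by
        rw [Finset.mem_range] at hi
        rw [if_neg (by omega)]) (by simp)] at h0
    rw [if_pos (by omega), if_pos (by omega), hp0, pow_zero, one_zpow, inv_one, mul_one,
      mul_one] at h0
    exact h0.symm
  have h2e : A * p e * (((q : ℂ) ^ e) ^ k)⁻¹ - B = 0 := by
    have h0 := hcoeff (2 * e)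
    rw [hR0, coeff_zero] at h0
    rw [Finset.sum_eq_single e (fun i hi hie ↦ by
        rw [Finset.mem_range] at hi
        rw [if_neg (by omega)]) (by simp),
      Finset.sum_eq_single 0 (fun i hi hi0 ↦ by
        rw [Finset.mem_range] at hi
        rw [if_neg (by omega)]) (by simp)] at h0
    rw [if_pos (by omega), if_pos (by omega), hp0, mul_one] at h0
    exact h0.symm
  have hqk : ((q : ℂ) ^ e) ^ k ≠ 0 := zpow_ne_zero _ (pow_ne_zero _ hq0)
  have hpe : p e ≠ 0 := by
    intro hpe
    rw [hpe, mul_zero, sub_zero] at h4e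
    exact hA h4e
  refine ⟨hpe, ?_⟩
  have hB : B = A * p e * (((q : ℂ) ^ e) ^ k)⁻¹ := (sub_eq_zero.mp h2e).symm
  rw [hB] at h4e
  field_simp at h4e
  -- `h4e : A * (q^e)^k = A * p_e * p_e` up to arrangement
  have : A * (((q : ℂ) ^ e) ^ k - p e ^ 2) = 0 := by linear_combination h4e
  rcases mul_eq_zero.mp this with h0 | h0
  · exact absurd h0 hA
  · exact (sub_eq_zero.mp h0).symm

end Algebra

/-! ### Step 3. Dirichlet series and completed `L`-functions -/

section Analysis

variable {L M : ℕ} [NeZero M] {k : ℤ}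

/-- **`L(F, s) = P(q^{-s}) L(g, s)`** when `aₙ(F) = ∑_{i ≤ e} p_i 𝟙_{q^i ∣ n} a_{n/q^i}(g)` (i.e.
`F = ∑ p_i g(q^i τ)`), on the half-plane `re s > k/2 + 1` of absolute convergence: the coefficient
sequence of `F` is the Dirichlet convolution of the finitely supported sequence `q^i ↦ p_i` with that
of `g` (Mathlib `LSeries_convolution'`). [folklore] -/
theorem cuspFormLSeries_eq_mul_of_cuspCoeff_eq_sum {F : CuspForm (Gamma0 L) k}
    {g : CuspForm (Gamma0 M) k} {q : ℕ} (hq : q.Prime) (e : ℕ) (p : ℕ → ℂ)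
    (hcoeff : ∀ n : ℕ, cuspCoeff F n =
      ∑ i ∈ Finset.range (e + 1), p i * (if q ^ i ∣ n then cuspCoeff g (n / q ^ i) else 0))
    {s : ℂ} (hs : (k : ℝ) / 2 + 1 < s.re) :
    cuspFormLSeries F s =
      (∑ i ∈ Finset.range (e + 1), p i / ((q ^ i : ℕ) : ℂ) ^ s) * cuspFormLSeries g s := by
  classical
  -- the finitely supported factor `π(q^i) = p_i`
  let π : ℕ → ℂ := fun n ↦ ∑ i ∈ Finset.range (e + 1), if n = q ^ i then p i else 0
  have hπ : ∀ i ∈ Finset.range (e + 1), π (q ^ i) = p i := by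
    intro i hi
    simp only [π]
    rw [Finset.sum_eq_single i (fun j _ hji ↦ if_neg fun h ↦ hji
      (Nat.pow_right_injective hq.two_le h).symm) (fun h ↦ absurd hi h), if_pos rfl]
  have hπ0 : ∀ n : ℕ, (∀ i ∈ Finset.range (e + 1), n ≠ q ^ i) → π n = 0 := fun n hn ↦
    Finset.sum_eq_zero fun i hi ↦ if_neg (hn i hi)
  -- `a(F) = π ⋆ a(g)`
  have hconv : ∀ {n : ℕ}, n ≠ 0 → cuspCoeff F n = LSeries.convolution π (cuspCoeff g) n := by
    intro n hn
    rw [LSeries.convolution_def, hcoeff n]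
    simp only
    rw [Nat.sum_divisorsAntidiagonal (f := fun a b ↦ π a * cuspCoeff g b)]
    simp only [π, Finset.sum_mul, ite_mul, zero_mul]
    rw [Finset.sum_comm]
    refine Finset.sum_congr rfl fun i _ ↦ ?_
    rw [Finset.sum_ite_eq']
    simp only [Nat.mem_divisors, ne_eq, hn, not_false_eq_true, and_true, mul_ite, mul_zero]
  -- `L(π, s) = ∑ p_i (q^i)^{-s}` (finite sum)
  have hterm0 : ∀ n ∉ (Finset.range (e + 1)).image (q ^ ·), LSeries.term π s n = 0 := by
    intro n hn
    rw [LSeries.term_def]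
    split_ifs with h0
    · rfl
    · rw [hπ0 n (fun i hi h ↦ hn (Finset.mem_image.mpr ⟨i, hi, h.symm⟩)), zero_div]
  have hLπ : LSeries π s = ∑ i ∈ Finset.range (e + 1), p i / ((q ^ i : ℕ) : ℂ) ^ s := by
    rw [LSeries, tsum_eq_sum hterm0, Finset.sum_image
      (fun i _ j _ h ↦ Nat.pow_right_injective hq.two_le h)]
    refine Finset.sum_congr rfl fun i hi ↦ ?_
    rw [LSeries.term_of_ne_zero (pow_ne_zero i hq.ne_zero), hπ i hi]
  have hπsum : LSeriesSummable π s := summable_of_ne_finset_zero hterm0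
  rw [cuspFormLSeries, cuspFormLSeries, LSeries_congr hconv s,
    LSeries_convolution' hπsum (LSeriesSummable_cuspCoeff_gamma0 g hs), hLπ]

/-- **`Λ_M(g, σ) ≠ 0` for large real `σ`** when `a₁(g) = 1`: on `re s > k/2 + 1` the entire continuation
is the raw product `M^{σ/2} (2π)^{-σ} Γ(σ) L(g, σ)`, whose first three factors are non-zero for
`σ > 0`, and `L(g, σ) → a₁(g) = 1` as `σ → +∞` (Mathlib `LSeries.tendsto_atTop`).  Stated along the
sequence `σ = k + 2t`, `t ∈ ℕ`. [folklore] -/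
theorem exists_forall_completedCuspFormL_ne_zero {g : CuspForm (Gamma0 M) k}
    (h1 : cuspCoeff g 1 = 1) {Λ : ℂ → ℂ} (hΛ : Λ ∈ completedCuspFormLContinuations M g) :
    ∃ t₀ : ℕ, ∀ t : ℕ, t₀ ≤ t → Λ ((((k : ℝ) + 2 * t : ℝ)) : ℂ) ≠ 0 := by
  -- `L(g, x) → 1`
  have habs : LSeries.abscissaOfAbsConv (cuspCoeff g) < ⊤ := by
    have hsum : LSeriesSummable (cuspCoeff g) ((((k : ℝ) / 2 + 2 : ℝ)) : ℂ) :=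
      LSeriesSummable_cuspCoeff_gamma0 g (by simp only [Complex.ofReal_re]; linarith)
    exact lt_of_le_of_lt hsum.abscissaOfAbsConv_le (EReal.coe_lt_top _)
  have hlim := LSeries.tendsto_atTop habs
  rw [h1] at hlim
  have hx : Tendsto (fun t : ℕ ↦ (k : ℝ) + 2 * t) atTop atTop :=
    tendsto_atTop_add_const_left _ _ (Tendsto.const_mul_atTop two_pos tendsto_natCast_atTop_atTop)
  have hev : ∀ᶠ t : ℕ in atTop, ‖LSeries (cuspCoeff g) (((k : ℝ) + 2 * t : ℝ) : ℂ) - 1‖ < 1 / 2 ∧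
      (k : ℝ) / 2 + 1 < (k : ℝ) + 2 * t ∧ 0 < (k : ℝ) + 2 * t := by
    refine ((hlim.comp hx).eventually (Metric.ball_mem_nhds (1 : ℂ) one_half_pos)).and
      ((hx.eventually (eventually_gt_atTop _)).and (hx.eventually (eventually_gt_atTop _)))
      |>.mono fun t ht ↦ ⟨?_, ht.2.1, ht.2.2⟩
    have := ht.1
    simp only [Function.comp_apply, dist_eq_norm] at this
    exact this
  obtain ⟨t₀, ht₀⟩ := eventually_atTop.mp hev
  refine ⟨t₀, fun t ht ↦ ?_⟩
  obtain ⟨hL1, hgt, hpos⟩ := ht₀ t ht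
  set x : ℝ := (k : ℝ) + 2 * t with hxdef
  have hre : (k : ℝ) / 2 + 1 < (x : ℂ).re := by rwa [Complex.ofReal_re]
  rw [hΛ.2 _ hre, completedCuspFormL, cuspFormLSeries]
  have hL0 : LSeries (cuspCoeff g) (x : ℂ) ≠ 0 := by
    intro h0
    rw [h0, zero_sub, norm_neg, norm_one] at hL1
    norm_num at hL1
  refine mul_ne_zero (mul_ne_zero (mul_ne_zero ?_ ?_) ?_) hL0
  · rw [Ne, Complex.cpow_eq_zero_iff, not_and_or]
    exact Or.inl (Nat.cast_ne_zero.mpr (NeZero.ne M))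
  · rw [Ne, Complex.cpow_eq_zero_iff, not_and_or]
    exact Or.inl (mul_ne_zero two_ne_zero (Complex.ofReal_ne_zero.mpr Real.pi_ne_zero))
  · exact Complex.Gamma_ne_zero_of_re_pos (by rwa [Complex.ofReal_re])

omit [NeZero M] in
/-- **Comparison of the completed `L`-functions.**  If `L(F, s) = P(s) L(g, s)` on `re s > k/2 + 1` for
cusp forms `F ∈ S_k(Γ₀(L))`, `g ∈ S_k(Γ₀(M))` with `L = D M` and an entire `P`, and `Λ_F`, `Λ_g` are
the entire continuations of `Λ_L(F, s)`, `Λ_M(g, s)`, then `Λ_F(s) = D^{s/2} P(s) Λ_g(s)` on `ℂ`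
(uniqueness of the continuation, `subsingleton_completedCuspFormLContinuations`); hence a functional
equation `Λ_F(s) = C_F Λ_F(k - s)` reads
`D^{s/2} P(s) Λ_g(s) = C_F D^{(k-s)/2} P(k-s) Λ_g(k-s)` (the argument of
`WeierstrassCurve.level_eq_and_sign_eq_of_completedLContinuations` with a Dirichlet-polynomial
factor). [folklore] -/
theorem completedL_twoSided_identity [NeZero L] {F : CuspForm (Gamma0 L) k} {g : CuspForm (Gamma0 M) k}
    {D : ℕ} (hLDM : L = D * M) {P : ℂ → ℂ} (hP : Differentiable ℂ P)
    (hLS : ∀ s : ℂ, (k : ℝ) / 2 + 1 < s.re → cuspFormLSeries F s = P s * cuspFormLSeries g s)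
    {ΛF : ℂ → ℂ} (hΛF : ΛF ∈ completedCuspFormLContinuations L F) {CF : ℂ}
    (hFE : ∀ s : ℂ, ΛF s = CF * ΛF (k - s))
    {Λg : ℂ → ℂ} (hΛg : Λg ∈ completedCuspFormLContinuations M g) (s : ℂ) :
    (D : ℂ) ^ (s / 2) * P s * Λg s =
      CF * ((D : ℂ) ^ (((k : ℂ) - s) / 2) * P ((k : ℂ) - s) * Λg ((k : ℂ) - s)) := by
  have hD0 : (D : ℂ) ≠ 0 := by
    have : D ≠ 0 := fun h ↦ NeZero.ne L (by rw [hLDM, h, zero_mul])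
    exact Nat.cast_ne_zero.mpr this
  -- `Λ'' = D^{s/2} P Λ_g` continues `Λ_L(F, s)`
  set Λ'' : ℂ → ℂ := fun s ↦ (D : ℂ) ^ (s / 2) * P s * Λg s with hΛ''
  have hmem : Λ'' ∈ completedCuspFormLContinuations L F := by
    refine ⟨?_, fun z hz ↦ ?_⟩
    · exact ((differentiable_id.div_const 2).const_cpow (Or.inl hD0)).mul hP |>.mul hΛg.1
    · simp only [hΛ'']
      rw [hΛg.2 z hz, completedCuspFormL, completedCuspFormL, hLS z hz]
      have hLz : (L : ℂ) ^ (z / 2) = (D : ℂ) ^ (z / 2) * (M : ℂ) ^ (z / 2) := by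
        rw [hLDM, Nat.cast_mul, ← Complex.ofReal_natCast D, ← Complex.ofReal_natCast M,
          Complex.mul_cpow_ofReal_nonneg (Nat.cast_nonneg D) (Nat.cast_nonneg M)]
      rw [hLz]
      ring
  have heq : Λ'' = ΛF := subsingleton_completedCuspFormLContinuations L F hmem hΛF
  have h := hFE s
  rw [← heq] at h
  simpa only [hΛ''] using h

end Analysis

/-! ### Step 4. Assembly: the twist is a newform -/

section Main

variable {N : ℕ} [NeZero N] {k : ℤ}

/-- Exponents of a base `q ≥ 2` are determined by the power (in `ℂ`, via norms). [folklore] -/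
theorem int_eq_of_zpow_natCast_eq {q : ℕ} (hq : 2 ≤ q) {a b : ℤ} (h : (q : ℂ) ^ a = (q : ℂ) ^ b) :
    a = b := by
  have h' : (q : ℝ) ^ a = (q : ℝ) ^ b := by
    have := congrArg norm h
    rwa [norm_zpow, norm_zpow, Complex.norm_natCast] at this
  exact zpow_right_injective₀ (by positivity) (by exact_mod_cast (show q ≠ 1 by omega)) h'

/-- A form with the Fourier coefficients of a newform of the same level is that newform (transport
along a propositional equality of levels; `eq_of_forall_cuspCoeff_eq_gamma0`). [folklore] -/
theorem IsNewform0.of_level_eq_of_cuspCoeff_eq {L M : ℕ} [NeZero L] [NeZero M] (hLM : L = M)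
    {F : CuspForm (Gamma0 L) k} {g : CuspForm (Gamma0 M) k} (hg : IsNewform0 g)
    (h : ∀ n : ℕ, cuspCoeff F n = cuspCoeff g n) : IsNewform0 F := by
  subst hLM
  rw [eq_of_forall_cuspCoeff_eq_gamma0 h]
  exact hg

/-- **Atkin–Li: the twist of a newform by a primitive quadratic character of prime-power conductor
prime to the level is a newform.**  For a newform `f ∈ S_k(Γ₀(N))`, a prime power `m = q^c`
(`c ≥ 1`) with `(N, m) = 1` and a primitive quadratic Dirichlet character `ψ` mod `m`, the twist
`f_ψ = ∑ ψ(n) aₙ(f) qⁿ ∈ S_k(Γ₀(N m²))` is a newform (`IsNewform0`) of level `N m²`.  (Atkin–Li 1978,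
§3, Thm. 3.1: the newform equivalent to `F_χ` has exact level `N m²` when `(cond χ, N) = 1`; for the
proof given here — packet newform `g` of level `M = N q^j`, `f_ψ = ∑ p_i g(q^i τ)`, and the comparison
of the functional equations of `Λ(f_ψ, s)` and `Λ(g, s)` forcing `M = N m²` — see the module
docstring.) [cite: AtkinLi1978, §3, Thm. 3.1] -/
theorem isNewform0_charTwist_of_isPrimePow_of_coprime {m : ℕ} [NeZero m]
    {ψ : DirichletCharacter ℂ m} (hψ : ψ.IsQuadratic) (hprim : ψ.IsPrimitive) (hm : IsPrimePow m)
    (hNm : N.Coprime m) {f : CuspForm (Gamma0 N) k} (hf : IsNewform0 f) :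
    IsNewform0 (charTwist (N * m ^ 2) (dvd_mul_right N (m ^ 2)) (dvd_mul_left (m ^ 2) N) hψ f) := by
  classical
  obtain ⟨q, c, hq, hc, rfl⟩ := (isPrimePow_nat_iff m).mp hm
  have hq0 : (q : ℂ) ≠ 0 := Nat.cast_ne_zero.mpr hq.ne_zero
  haveI : NeZero (N * (q ^ c) ^ 2) := ⟨mul_ne_zero (NeZero.ne N) (pow_ne_zero 2 (NeZero.ne _))⟩
  set F : CuspForm (Gamma0 (N * (q ^ c) ^ 2)) k :=
    charTwist (N * (q ^ c) ^ 2) (dvd_mul_right N ((q ^ c) ^ 2)) (dvd_mul_left ((q ^ c) ^ 2) N) hψ f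
    with hFdef
  -- Fourier coefficients of the twist
  have hFcoeff : ∀ n : ℕ, cuspCoeff F n = ψ n * cuspCoeff f n :=
    fun n ↦ cuspCoeff_charTwist _ _ _ hψ hprim f n
  have hf1 : cuspCoeff f 1 = 1 := hf.2.2
  -- the packet newform `g` of level `M`, `M ∣ N m²`, `N ∣ M m²`
  obtain ⟨M, _, hML, hNM, g, hg, hpk⟩ := exists_isNewform0_charTwist_packet hψ hprim hf
  have hT : ∀ (p : ℕ) (hp : p.Prime), ¬ p ∣ N * (q ^ c) ^ 2 →
      (haveI : NeZero p := ⟨hp.ne_zero⟩; heckeT (Gamma0 (N * (q ^ c) ^ 2)) k p F) =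
        cuspCoeff g p • F := by
    intro p hp hpL
    haveI : NeZero p := ⟨hp.ne_zero⟩
    rw [hpk p hp hpL]
    exact heckeT_charTwist_of_isNewform0 _ _ _ hψ hprim hf hp hpL
  -- `M = N q^j` with `j ≤ 2c`
  obtain ⟨M₁, rfl⟩ : N ∣ M := (Nat.Coprime.pow_right 2 hNm).dvd_of_dvd_mul_right hNM
  haveI : NeZero M₁ := ⟨fun h ↦ NeZero.ne (N * M₁) (by rw [h, mul_zero])⟩
  have hM₁ : M₁ ∣ q ^ (c * 2) := by
    rw [pow_mul]
    exact Nat.dvd_of_mul_dvd_mul_left (NeZero.pos N) hML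
  obtain ⟨j, hj, rfl⟩ := (Nat.dvd_prime_pow hq).mp hM₁
  -- `e = 2c - j`, `L / M = q^e`, `L = q^e M`
  obtain ⟨e, he⟩ : ∃ e : ℕ, c * 2 = j + e := ⟨c * 2 - j, by omega⟩
  have hLM : N * (q ^ c) ^ 2 / (N * q ^ j) = q ^ e := by
    rw [Nat.mul_div_mul_left _ _ (NeZero.pos N), ← pow_mul, he, Nat.pow_div (by omega) hq.pos,
      Nat.add_sub_cancel_left]
  have hLDM : N * (q ^ c) ^ 2 = q ^ e * (N * q ^ j) := by
    rw [← pow_mul, he, pow_add]; ring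
  -- `f_ψ = ∑_{i ≤ e} p_i g(q^i τ)` on coefficients
  obtain ⟨cf, hcf⟩ := exists_cuspCoeff_eq_sum_of_eigenpacket (h := F) hML hg hT
  rw [hLM, Nat.divisors_prime_pow hq e] at hcf
  simp only [Finset.sum_map, Function.Embedding.coeFn_mk] at hcf
  set p : ℕ → ℂ := fun i ↦ cf (q ^ i) with hpdef
  have hcf' : ∀ n : ℕ, cuspCoeff F n =
      ∑ i ∈ Finset.range (e + 1), p i * (if q ^ i ∣ n then cuspCoeff g (n / q ^ i) else 0) := hcf
  -- the recursion at the powers of `q`: `a_{q^r}(f_ψ) = 𝟙_{r = 0}`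
  have hrec : ∀ r : ℕ, ∑ i ∈ Finset.range (e + 1),
      p i * (if i ≤ r then cuspCoeff g (q ^ (r - i)) else 0) = if r = 0 then 1 else 0 := by
    intro r
    have hl : cuspCoeff F (q ^ r) = if r = 0 then 1 else 0 := by
      rw [hFcoeff]
      rcases Nat.eq_zero_or_pos r with rfl | hr
      · rw [if_pos rfl, pow_zero, Nat.cast_one, map_one, one_mul, hf1]
      · rw [if_neg hr.ne', MulChar.map_nonunit _ ?_, zero_mul]
        rw [ZMod.isUnit_iff_coprime]
        intro hcop
        have h1 : Nat.Coprime q q :=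
          Nat.Coprime.coprime_dvd_right (dvd_pow_self q hc.ne')
            (Nat.Coprime.coprime_dvd_left (dvd_pow_self q hr.ne') hcop)
        exact hq.ne_one (Nat.Coprime.eq_one_of_dvd h1 dvd_rfl)
    rw [← hl, hcf' (q ^ r)]
    refine Finset.sum_congr rfl fun i _ ↦ ?_
    by_cases hir : i ≤ r
    · rw [if_pos hir, if_pos ((Nat.pow_dvd_pow_iff_le_right hq.one_lt).mpr hir),
        Nat.pow_div hir hq.pos]
    · rw [if_neg hir, if_neg (mt (Nat.pow_dvd_pow_iff_le_right hq.one_lt).mp hir)]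
  obtain ⟨hp0, hp1, hp2, hp3⟩ := coeff_values_of_coeff_recursion hg hq e p hrec
  rcases Nat.eq_zero_or_pos e with he0 | he1
  · -- `e = 0`: `M = N m²` and `f_ψ = g`
    subst he0
    have hlev : N * (q ^ c) ^ 2 = N * q ^ j := by rw [← pow_mul, he, add_zero]
    refine IsNewform0.of_level_eq_of_cuspCoeff_eq hlev hg fun n ↦ ?_
    rw [hcf' n, Finset.sum_range_one, hp0, pow_zero, one_mul, if_pos (one_dvd n), Nat.div_one]
  · -- `e ≥ 1`: the two functional equations are incompatible
    exfalso
    -- `L(f_ψ, s) = P(s) L(g, s)`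
    set P : ℂ → ℂ := fun s ↦ ∑ i ∈ Finset.range (e + 1), p i / ((q ^ i : ℕ) : ℂ) ^ s with hPdef
    have hPdiff : Differentiable ℂ P := by
      refine Differentiable.fun_sum fun i _ ↦ ?_
      have hqi : ((q ^ i : ℕ) : ℂ) ≠ 0 := Nat.cast_ne_zero.mpr (pow_ne_zero i hq.ne_zero)
      exact (differentiable_const _).div (differentiable_id.const_cpow (Or.inl hqi))
        fun s ↦ by rw [Ne, cpow_eq_zero_iff, not_and_or]; exact Or.inl hqi
    have hLS : ∀ s : ℂ, (k : ℝ) / 2 + 1 < s.re →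
        cuspFormLSeries F s = P s * cuspFormLSeries g s :=
      fun s hs ↦ cuspFormLSeries_eq_mul_of_cuspCoeff_eq_sum hq e p hcf' hs
    -- functional equation of `Λ(f_ψ, s)` at level `N m²`
    obtain ⟨ε, hε1, hε⟩ := IsNewform0.exists_frickeInvolution_eq_smul_holds hf
    have hFw : frickeInvolution (N * (q ^ c) ^ 2) k F = (ψ (-1) * ψ N * ε) • F :=
      frickeInvolution_charTwist_of_eq_smul hNm hψ hε
    obtain ⟨ΛF, hΛF, hFE_F⟩ := exists_functional_equation_of_frickeInvolution_eq_smul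
      (exists_completedCuspFormL_functional_equation_holds (N * (q ^ c) ^ 2) k) hFw
    -- functional equation of `Λ(g, s)` at level `M`
    obtain ⟨Λg, hΛg, hFE_g⟩ := IsNewform0.exists_functional_equation_holds hg
    have hεg := IsNewform0.frickeEigenvalue_eq_one_or_eq_neg_one_holds hg
    -- the two-sided identity, and non-vanishing of `Λ(g, k + 2t)`
    have hid := completedL_twoSided_identity (F := F) (g := g) hLDM hPdiff hLS hΛF hFE_F hΛg
    obtain ⟨t₀, ht₀⟩ := exists_forall_completedCuspFormL_ne_zero (g := g) hg.2.2 hΛg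
    -- constants
    set CF : ℂ := Complex.I ^ k * (ψ (-1) * ψ N * ε) with hCF
    set c₀ : ℂ := ((q ^ e : ℕ) : ℂ) ^ ((k : ℂ) / 2) with hc₀
    have hDq : ((q ^ e : ℕ) : ℂ) ≠ 0 := Nat.cast_ne_zero.mpr (pow_ne_zero e hq.ne_zero)
    have hCF0 : CF ≠ 0 := by
      have hI : Complex.I ^ k ≠ 0 := zpow_ne_zero k Complex.I_ne_zero
      have h1 : ψ (-1) ≠ 0 := by
        intro h0
        have := apply_sq_eq_one_of_isQuadratic hψ (isUnit_one.neg : IsUnit (-1 : ZMod (q ^ c)))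
        rw [h0] at this; norm_num at this
      have h2 : ψ N ≠ 0 := by
        intro h0
        have := apply_sq_eq_one_of_isQuadratic hψ ((ZMod.isUnit_iff_coprime N (q ^ c)).mpr hNm)
        rw [h0] at this; norm_num at this
      have h3 : ε ≠ 0 := by rcases hε1 with h | h <;> rw [h] <;> norm_num
      exact mul_ne_zero hI (mul_ne_zero (mul_ne_zero h1 h2) h3)
    have hA : CF * c₀ ≠ 0 := mul_ne_zero hCF0 (by
      rw [hc₀, Ne, cpow_eq_zero_iff, not_and_or]; exact Or.inl hDq)
    -- the identity at `s = -2t`, in the form of `sq_eq_of_twoSided_identity`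
    have hK : ∀ t : ℕ, t₀ ≤ t →
        CF * c₀ * (q : ℂ) ^ (e * t) * ∑ i ∈ Finset.range (e + 1),
            p i * (((q : ℂ) ^ i) ^ k)⁻¹ * ((q : ℂ) ^ (2 * i * t))⁻¹ =
          Complex.I ^ k * frickeEigenvalue g * ((q : ℂ) ^ (e * t))⁻¹ *
            ∑ i ∈ Finset.range (e + 1), p i * (q : ℂ) ^ (2 * i * t) := by
      intro t ht
      set T : ℂ := (((k : ℝ) + 2 * t : ℝ) : ℂ) with hT
      have hT' : T = (k : ℂ) + 2 * (t : ℂ) := by rw [hT]; push_cast; ring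
      set s : ℂ := (k : ℂ) - T with hsdef
      have hs : s = -(2 * (t : ℂ)) := by rw [hsdef, hT']; ring
      have hks : (k : ℂ) - s = T := by rw [hsdef]; ring
      have hΛT : Λg T ≠ 0 := ht₀ t ht
      -- `hid` at `s`, with `Λ_g(s) = i^k ε_g Λ_g(T)`
      have h1 := hid s
      rw [hks, hFE_g s, hks] at h1
      -- cancel `Λ_g(T)`
      have h2 : ((q ^ e : ℕ) : ℂ) ^ (s / 2) * P s * (Complex.I ^ k * frickeEigenvalue g) =
          CF * (((q ^ e : ℕ) : ℂ) ^ (T / 2) * P T) := by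
        have := mul_right_cancel₀ hΛT (by
          calc ((q ^ e : ℕ) : ℂ) ^ (s / 2) * P s * (Complex.I ^ k * frickeEigenvalue g) * Λg T
              = ((q ^ e : ℕ) : ℂ) ^ (s / 2) * P s * (Complex.I ^ k * frickeEigenvalue g * Λg T) := by
                ring
            _ = CF * (((q ^ e : ℕ) : ℂ) ^ (T / 2) * P T * Λg T) := h1
            _ = CF * (((q ^ e : ℕ) : ℂ) ^ (T / 2) * P T) * Λg T := by ring)
        exact this
      -- evaluate the powers
      have hD1 : ((q ^ e : ℕ) : ℂ) ^ (s / 2) = ((q : ℂ) ^ (e * t))⁻¹ := by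
        rw [hs, show -(2 * (t : ℂ)) / 2 = -((t : ℕ) : ℂ) by ring, cpow_neg, cpow_natCast]
        push_cast
        rw [← pow_mul]
      have hD2 : ((q ^ e : ℕ) : ℂ) ^ (T / 2) = c₀ * (q : ℂ) ^ (e * t) := by
        rw [hT', show ((k : ℂ) + 2 * (t : ℂ)) / 2 = (k : ℂ) / 2 + ((t : ℕ) : ℂ) by ring,
          cpow_add _ _ hDq, cpow_natCast, hc₀]
        push_cast
        rw [← pow_mul]
      have hP1 : P s = ∑ i ∈ Finset.range (e + 1), p i * (q : ℂ) ^ (2 * i * t) := by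
        rw [hPdef]
        refine Finset.sum_congr rfl fun i _ ↦ ?_
        have hqi : ((q ^ i : ℕ) : ℂ) ≠ 0 := Nat.cast_ne_zero.mpr (pow_ne_zero i hq.ne_zero)
        rw [hs, show -(2 * (t : ℂ)) = -(((2 * t : ℕ) : ℂ)) by push_cast; ring, cpow_neg,
          cpow_natCast, div_inv_eq_mul]
        push_cast
        rw [← pow_mul, mul_comm i (2 * t), mul_assoc, mul_comm t i, ← mul_assoc]
      have hP2 : P T = ∑ i ∈ Finset.range (e + 1),
          p i * (((q : ℂ) ^ i) ^ k)⁻¹ * ((q : ℂ) ^ (2 * i * t))⁻¹ := by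
        rw [hPdef]
        refine Finset.sum_congr rfl fun i _ ↦ ?_
        have hqi : ((q ^ i : ℕ) : ℂ) ≠ 0 := Nat.cast_ne_zero.mpr (pow_ne_zero i hq.ne_zero)
        rw [hT', show (k : ℂ) + 2 * (t : ℂ) = (((k + 2 * t : ℤ)) : ℂ) by push_cast; ring,
          cpow_intCast, zpow_add₀ hqi, show ((2 * t : ℤ)) = ((2 * t : ℕ) : ℤ) by push_cast; ring,
          zpow_natCast]
        push_cast
        rw [← pow_mul, mul_comm i (2 * t), mul_assoc, mul_comm t i, ← mul_assoc, div_eq_mul_inv,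
          mul_inv]
        ring
      rw [hD1, hD2, hP1, hP2] at h2
      linear_combination -h2
    obtain ⟨hpe0, hpe2⟩ := sq_eq_of_twoSided_identity hq.two_le e k hp0 hA t₀ hK
    -- case analysis on `e`
    rcases Nat.lt_or_ge e 3 with he3 | he3
    · interval_cases e
      · -- `e = 1`: `p₁ = -a_q(g)`, `q ∣ M`
        have hj1 : 1 ≤ j := by omega
        rw [hp1 le_rfl, neg_sq, pow_one] at hpe2
        rcases Nat.lt_or_ge j 2 with hj2 | hj2
        · -- `q ∥ M`: `a_q(g)² = q^{k-2}` (Atkin–Lehner)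
          have hj' : j = 1 := by omega
          subst hj'
          haveI : Fact q.Prime := ⟨hq⟩
          have hNq : N * q ^ 1 = q * N := by ring
          have hNq' : Nat.Coprime N q := Nat.Coprime.coprime_dvd_right (dvd_pow_self q hc.ne') hNm
          have hqN : ¬ q ∣ N := fun h ↦ hq.ne_one (Nat.Coprime.eq_one_of_dvd hNq'.symm h)
          have hlam := hg.atkinLehnerEigenvalueAt_eq_of_not_dvd q hNq hqN
          have hlam1 := hg.atkinLehnerEigenvalueAt_eq_one_or_eq_neg_one hq
            (dvd_mul_of_dvd_right (dvd_pow_self q one_ne_zero) N)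
          have hr : ((((q : ℝ) ^ (1 - (k : ℝ) / 2) : ℝ) : ℂ)) ^ 2 = (q : ℂ) ^ (2 - k) := by
            rw [← Complex.ofReal_pow, ← Real.rpow_natCast,
              ← Real.rpow_mul (Nat.cast_nonneg q), show (1 - (k : ℝ) / 2) * ((2 : ℕ) : ℝ) =
                ((2 - k : ℤ) : ℝ) by push_cast; ring, Real.rpow_intCast]
            push_cast
            rfl
          have hsq : atkinLehnerEigenvalueAt g q ^ 2 = 1 := by
            rcases hlam1 with h | h <;> rw [h] <;> norm_num
          rw [hlam, mul_pow, neg_sq, hr] at hsq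
          change (q : ℂ) ^ (2 - k) * cuspCoeff g q ^ 2 = 1 at hsq
          rw [hpe2] at hsq
          rw [← zpow_add₀ hq0, show (2 - k + k : ℤ) = 2 by ring] at hsq
          have h22 : (2 : ℤ) = 0 := int_eq_of_zpow_natCast_eq hq.two_le (by rw [hsq, zpow_zero])
          omega
        · -- `q² ∣ M`: `a_q(g) = 0`
          have hsqdvd : q ^ 2 ∣ N * q ^ j := dvd_mul_of_dvd_right (pow_dvd_pow q hj2) N
          have h0 : cuspCoeff g q = 0 := cuspCoeff_eq_zero_of_sq_dvd_of_mem_newSubspace0 hg.1 hq hsqdvd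
          exact hpe0 (by rw [hp1 le_rfl, h0, neg_zero])
      · -- `e = 2`: `p₂ = 𝟙_{q ∤ M} q^{k-1}`
        rw [hp2 le_rfl] at hpe0 hpe2
        split_ifs at hpe0 hpe2 with hqM
        · exact hpe0 rfl
        · rw [← zpow_natCast, ← zpow_mul, ← zpow_natCast, ← zpow_mul] at hpe2
          have := int_eq_of_zpow_natCast_eq hq.two_le hpe2
          push_cast at this
          omega
    · -- `e ≥ 3`: `p_e = 0`
      exact hpe0 (hp3 e he3 le_rfl)

end Main

end Literature.NumberTheory.EllipticCurves.ModularForms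

end
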